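import Literature.AnabelianGeometry.EtaleTheta.Discharge.Sec4Thm44ivTree
import Literature.AlgebraicGeometry.Frobenioids.PadicFrobenioidUnitGroups

/-!
# [EtTh] Prop 4.3 (ii) and Thm 4.4 (iv) AS TYPED hold for EVERY setting of §4 — the universal closures

Mochizuki, *The étale theta function and its Frobenioid-theoretic manifestations*, Publ. RIMS **45**
(2009), §4, Prop. 4.3 (ii) p.91, Thm. 4.4 (iv) p.94 [cite: MochizukiEtTh2009, Prop 4.3 (ii) p.91;
Thm 4.4 (iv) p.94]; Def. 3.6 (ii)(a) p.77 ("`Φ^{bs-fld}` … is monoprime").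

abc-iut cell, block F (fact-proving wave), seat abc-iut-f-111 (tranche 111: FACT-LIST rows F-0731
`BiKummerSetting.Thm44_iv`; the by-product F-0730 `BiKummerSetting.Prop43_ii` is abc-iut-f-110's row —
coordinated on HOME/STATUS 06:4xZ).  PROOF-ONLY companion (no definition, no named fact, no instance) of
abc-iut-L2-t3's `BiKummerRoots.lean`; it removes the LAST structural hypothesis of the cell's discharges of
these two typed statements:

* abc-iut-w5-d063's `prop43_ii_of` / `thm44_iv_of` (`Discharge/Sec4Prop43ii.lean`) prove them modulo
  `Φ` divisorial and `B` group-like; abc-iut-L6-t23's `prop43_ii_of'` / `thm44_iv_of'`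
  (`Discharge/Sec4Thm44ivTree.lean`) discharge `B` group-like (`ratFnFunctor_isGroupLike_holds`), leaving
  `hΦd : Objectwise IsDivisorial S.tf.divisorMonoid`, which over an ARBITRARY [FrdI] category vocabulary
  `VD : FrdICatStub D` is not derivable (the Def. 3.6 (ii) clause "divisorial monoid on `D`" is the
  vocabulary field `VD.IsDivisorialOn`).
* Here `hΦd` is shown to be UNNECESSARY.  The printed proof of Prop. 4.3 (ii) ("[FrdI], Definition 1.3,
  (iii), (d); the fact that Frobenioids are always totally epimorphic", p.91) uses divisoriality of `Φ`
  only through two facts about AUTOMORPHISMS of the model Frobenioid `C` ([FrdI] Thm. 5.2 (i)): (1) a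
  morphism `s` with `Base(s)` an isomorphism is left-cancellable AGAINST AUTOMORPHISMS, and (2) a unit
  `ζ_A ∈ O^×(A_N)` lifts along the base-equivalent pre-steps `s'_N, s''_N` to one `ζ ∈ O^×(B_N)`.  Both
  hold in EVERY tempered Frobenioid, because the zero divisor of an automorphism is a UNIT of `Φ(A)` and
  — the one new observation — **a unit `u` of `Φ(A)` that fixes some `z ∈ Φ(A)` (`u·z = z`) is trivial**:
  `u·z = z` gives `[u] = 0` in `(Φ^{ℝ-log})^gp`, so `u, u⁻¹ ∈ Φ^{bs-fld}(A) = Φ(A) ×_{(Φ^{ℝ-log})^gp} ℝ·Φ₀^cnst`,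
  which is MONOPRIME (Def. 3.6 (ii)(a), the REAL field `TemperedFrobenioid.isMonoprime_bsFld`), hence
  sharp (`TemperedFrobenioid.eq_one_of_isUnit_of_mul_eq`).  With `B` group-like (hence integral) this
  yields (1) `TemperedFrobenioid.aut_eq_of_comp_eq` and (2) `BiKummerSetting.NthRoot.exists_units_lift'`
  (the lift is written down: `(1, id, (b⁻¹)^* Div ζ_A, (b⁻¹)^* u_{ζ_A})`, `b = Base(s'_N) = Base(s''_N)`).

Consequences (closed universal closures, FQ types):
* `BiKummerSetting.prop43_ii_holds : ∀ … (S : BiKummerSetting X T D VD) (pullFrac), S.Prop43_ii pullFrac`;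
* `BiKummerSetting.thm44_iv_holds  : ∀ … (h : Thm44Hyp S₁ S₂) (ψ) (pullFrac₁) (pullFrac₂),
  Thm44_iv h ψ pullFrac₁ pullFrac₂` — by abc-iut-L2-t3's `thm44_iv_of_prop43_ii` (`Discharge/Sec4Thm44.lean`).
So the typed statements `Prop43_ii`, `Thm44_iv` are THEOREMS for every instance of the interface stack,
not assumptions.  (What they say is exactly what `BiKummerRoots.lean` documents: typed (ii) is the
same-`N`-th-root case of print's (ii); typed (iv) carries the `Ψ`-identifications as hypotheses — both
WEAKER than print on those axes; nothing here changes that.)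
HONEST FRAMING: [EtTh] is a published, refereed paper; a FACT-LIST row is an assumption label, and this
file merely removes two of them by kernel proof; nothing here asserts that such data exist for an actual
curve; no side is taken on [IUTchIII] Cor. 3.12; typed ≠ proved for anything not proved here.
-/

noncomputable section

namespace Literature.AnabelianGeometry.EtaleTheta

open CategoryTheory Opposite Literature.AlgebraicGeometry.Frobenioids
open Literature.AlgebraicGeometry.Frobenioids.PreFrobenioid (pull_inv_pull_eq pull_pull_inv_eq
  pull_injective)

universe u₀ v₀ u v w

/-! ### Units of `Φ(A)` with a fixed point are trivial (Def. 3.6 (ii)(a): `Φ^{bs-fld}` monoprime) -/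

namespace TemperedFrobenioid

variable {D₀ : Type u₀} [Category.{v₀} D₀] {V : FrdIMonoidStub.{w}}
  {T : RealifiedDivisorMonoids (D₀ := D₀) V} {D : Type u} [Category.{v} D]
  {VD : FrdICatStub.{u, v, w} D} (C₀ : TemperedFrobenioid T D VD)

/-- **A unit of the divisor monoid `Φ(A)` of a tempered Frobenioid that fixes an element is trivial**:
if `u ∈ Φ(A)^×` and `u · z = z` for some `z ∈ Φ(A)`, then `u = 1`.  Indeed `u · z = z` in
`Φ^{ℝ-log}(A)` gives `[u] = 0` in `(Φ^{ℝ-log})^gp(A)`, so `u` and `u⁻¹` lie in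
`Φ^{bs-fld}(A) = {x ∈ Φ(A) | [x] ∈ ℝ·Φ₀^cnst}`, which is monoprime ([EtTh] Def. 3.6 (ii)(a),
`isMonoprime_bsFld`), hence sharp ([FrdI] Def. 1.1 (i)). [cite: MochizukiEtTh2009, Def 3.6 p.77] -/
theorem eq_one_of_isUnit_of_mul_eq (A : Dᵒᵖ) {u z : C₀.Φ.carrier A} (hu : IsUnit u)
    (hz : u * z = z) : u = 1 := by
  obtain ⟨w, hw⟩ := hu.exists_right_inv
  -- `[u] = 0 = [w]` in the groupification of the ambient monoid `Φ^{ℝ-log}(A)`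
  have hz' : (u.1 : T.ΦR.obj (op (C₀.base.obj (unop A)))) * z.1 = z.1 := by
    rw [← Submonoid.coe_mul, hz]
  have hw' : (w.1 : T.ΦR.obj (op (C₀.base.obj (unop A)))) * z.1 = z.1 := by
    have e : w * (u * z) = w * z := by rw [hz]
    rw [← mul_assoc, mul_comm w u, hw, one_mul] at e
    rw [← Submonoid.coe_mul, ← e]
  have hofu : Algebra.GrothendieckGroup.of (u.1 : T.ΦR.obj (op (C₀.base.obj (unop A)))) = 1 := by
    have e := congrArg Algebra.GrothendieckGroup.of hz'
    rw [map_mul] at e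
    exact mul_right_cancel (e.trans (one_mul _).symm)
  have hofw : Algebra.GrothendieckGroup.of (w.1 : T.ΦR.obj (op (C₀.base.obj (unop A)))) = 1 := by
    have e := congrArg Algebra.GrothendieckGroup.of hw'
    rw [map_mul] at e
    exact mul_right_cancel (e.trans (one_mul _).symm)
  -- membership of `u`, `w` in `Φ^{bs-fld}(A)`
  have hmu : (u.1 : T.ΦR.obj (op (C₀.base.obj (unop A)))) ∈
      C₀.Φ.carrier A ⊓ (T.cnstR (op (C₀.base.obj (unop A)))).toSubmonoid.comap
        Algebra.GrothendieckGroup.of := by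
    refine Submonoid.mem_inf.2 ⟨u.2, ?_⟩
    have h1 : Algebra.GrothendieckGroup.of (u.1 : T.ΦR.obj (op (C₀.base.obj (unop A)))) ∈
        (T.cnstR (op (C₀.base.obj (unop A)))).toSubmonoid := by
      rw [hofu]; exact one_mem _
    exact h1
  have hmw : (w.1 : T.ΦR.obj (op (C₀.base.obj (unop A)))) ∈
      C₀.Φ.carrier A ⊓ (T.cnstR (op (C₀.base.obj (unop A)))).toSubmonoid.comap
        Algebra.GrothendieckGroup.of := by
    refine Submonoid.mem_inf.2 ⟨w.2, ?_⟩
    have h1 : Algebra.GrothendieckGroup.of (w.1 : T.ΦR.obj (op (C₀.base.obj (unop A)))) ∈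
        (T.cnstR (op (C₀.base.obj (unop A)))).toSubmonoid := by
      rw [hofw]; exact one_mem _
    exact h1
  -- `Φ^{bs-fld}(A)` is monoprime, hence sharp
  have hsharp := (C₀.isMonoprime_bsFld A).isSharp
  have hunit : IsUnit (⟨(u.1 : T.ΦR.obj (op (C₀.base.obj (unop A)))), hmu⟩ :
      ↥(C₀.Φ.carrier A ⊓ (T.cnstR (op (C₀.base.obj (unop A)))).toSubmonoid.comap
        Algebra.GrothendieckGroup.of)) := by
    refine IsUnit.of_mul_eq_one ⟨(w.1 : T.ΦR.obj (op (C₀.base.obj (unop A)))), hmw⟩ (Subtype.ext ?_)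
    change (u.1 : T.ΦR.obj (op (C₀.base.obj (unop A)))) * w.1 = 1
    rw [← Submonoid.coe_mul, hw, Submonoid.coe_one]
  have h1 := congrArg Subtype.val (hsharp.eq_one_of_isUnit _ hunit)
  exact Subtype.ext h1

/-! ### The model Frobenioid of a tempered Frobenioid: cancellation against automorphisms -/

/-- **Base-isomorphisms are left-cancellable against automorphisms, in EVERY tempered Frobenioid**:
for `s : X → Y` with `Base(s)` an isomorphism and `σ, σ' ∈ Aut_C(Y)`, `σ ∘ s = σ' ∘ s` implies
`σ = σ'` ("Frobenioids are always totally epimorphic", proof of Prop. 4.3 (ii), p.91 — here without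
`Φ` divisorial: the zero divisors of `σ, σ'` are units of `Φ`, and the unit `Div(σ')⁻¹·Div(σ)` fixes
`Base(s)^* Div(σ') · Div(s)`, so it is trivial by `eq_one_of_isUnit_of_mul_eq`; `B` is group-like).
[cite: MochizukiEtTh2009, Prop 4.3 (ii) p.91] -/
theorem aut_eq_of_comp_eq {X Y : C₀.category} (s : X ⟶ Y) [IsIso (ModelFrobenioid.baseMap s)]
    {σ σ' : Aut Y} (e : s ≫ σ.hom = s ≫ σ'.hom) : σ = σ' := by
  haveI : IsCancelMul (C₀.ratFnFunctor.obj (op X.base)) :=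
    isIntegral_iff_isCancelMul.mp (C₀.ratFnFunctor_isGroupLike_holds X.base).isPreDivisorial.isIntegral
  have h1 : ModelFrobenioid.degFr σ.hom = 1 := ModelFrobenioid.degFr_eq_one_of_isIso σ.hom
  have h1' : ModelFrobenioid.degFr σ'.hom = 1 := ModelFrobenioid.degFr_eq_one_of_isIso σ'.hom
  have hdeg : ModelFrobenioid.degFr σ.hom = ModelFrobenioid.degFr σ'.hom := by rw [h1, h1']
  have hb : ModelFrobenioid.baseMap σ.hom = ModelFrobenioid.baseMap σ'.hom := by
    have e' := congrArg ModelFrobenioid.baseMap e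
    rw [ModelFrobenioid.baseMap_comp, ModelFrobenioid.baseMap_comp] at e'
    exact (cancel_epi (ModelFrobenioid.baseMap s)).mp e'
  -- zero divisors
  have hd := congrArg ModelFrobenioid.div e
  rw [ModelFrobenioid.div_comp_pull, ModelFrobenioid.div_comp_pull, h1, h1', PNat.one_coe, pow_one]
    at hd
  have huσ : IsUnit (ModelFrobenioid.div σ.hom) := PreFrobenioid.isUnit_div_of_isIso C₀.toElem σ.hom
  have huσ' : IsUnit (ModelFrobenioid.div σ'.hom) := PreFrobenioid.isUnit_div_of_isIso C₀.toElem σ'.hom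
  obtain ⟨a', ha'⟩ := huσ'.map (pull C₀.divisorMonoid (ModelFrobenioid.baseMap s))
  have key : ((a'⁻¹ : (C₀.divisorMonoid.obj (op X.base))ˣ) : C₀.divisorMonoid.obj (op X.base)) *
      pull C₀.divisorMonoid (ModelFrobenioid.baseMap s) (ModelFrobenioid.div σ.hom) *
      (pull C₀.divisorMonoid (ModelFrobenioid.baseMap s) (ModelFrobenioid.div σ'.hom) *
        ModelFrobenioid.div s) =
      pull C₀.divisorMonoid (ModelFrobenioid.baseMap s) (ModelFrobenioid.div σ'.hom) *
        ModelFrobenioid.div s := by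
    rw [mul_assoc, mul_left_comm (pull C₀.divisorMonoid (ModelFrobenioid.baseMap s) (ModelFrobenioid.div σ.hom)),
      hd, ← mul_assoc, ← ha', Units.inv_mul, one_mul]
  have hv : IsUnit (((a'⁻¹ : (C₀.divisorMonoid.obj (op X.base))ˣ) : C₀.divisorMonoid.obj (op X.base)) *
      pull C₀.divisorMonoid (ModelFrobenioid.baseMap s) (ModelFrobenioid.div σ.hom)) :=
    (Units.isUnit _).mul (huσ.map _)
  have hone := C₀.eq_one_of_isUnit_of_mul_eq (op X.base) hv key
  have hdiv : ModelFrobenioid.div σ.hom = ModelFrobenioid.div σ'.hom := by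
    apply pull_injective (ModelFrobenioid.baseMap s)
    rw [← ha']
    exact (Units.inv_mul_eq_one.mp hone).symm
  -- units
  have hu := congrArg ModelFrobenioid.unit e
  rw [ModelFrobenioid.unit_comp_pull, ModelFrobenioid.unit_comp_pull, h1, h1', PNat.one_coe, pow_one]
    at hu
  have hunit : ModelFrobenioid.unit σ.hom = ModelFrobenioid.unit σ'.hom :=
    pull_injective (ModelFrobenioid.baseMap s) (mul_right_cancel hu)
  exact Iso.ext (ModelFrobenioid.hom_ext hdeg hb hdiv hunit)

/-- **Lifted automorphisms along a base-isomorphism respect conjugation** (the "total epimorphicity"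
step of the proof of Prop. 4.3 (ii), p.91), in EVERY tempered Frobenioid: if `σ`, `σ'`, `ζ_Y ∈ Aut_C(Y)`
lift `τ`, `τ'`, `ζ_X ∈ Aut_C(X)` along `s : X → Y` (`Base(s)` an isomorphism) and `τ' = ζ_X τ ζ_X⁻¹`, then
`σ' = ζ_Y σ ζ_Y⁻¹` — abc-iut-w5-d063's `ModelFrobenioid.aut_conj_of_comp_eq` without `Φ` divisorial.
[cite: MochizukiEtTh2009, Prop 4.3 (ii) p.91] -/
theorem aut_conj_of_comp_eq {X Y : C₀.category} (s : X ⟶ Y) [IsIso (ModelFrobenioid.baseMap s)]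
    {τ τ' ζX : Aut X} {σ σ' ζY : Aut Y} (hσ : s ≫ σ.hom = τ.hom ≫ s)
    (hσ' : s ≫ σ'.hom = τ'.hom ≫ s) (hζ : s ≫ ζY.hom = ζX.hom ≫ s) (hτ : τ' = ζX * τ * ζX⁻¹) :
    σ' = ζY * σ * ζY⁻¹ := by
  have e1 : ζX.inv ≫ s = s ≫ ζY.inv := by
    rw [Iso.inv_comp_eq, ← Category.assoc, ← hζ, Category.assoc, Iso.hom_inv_id, Category.comp_id]
  apply C₀.aut_eq_of_comp_eq s
  rw [hσ', hτ]
  simp only [Aut.Aut_mul_def, Aut.Aut_inv_def, Iso.trans_hom, Iso.symm_hom, Category.assoc]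
  rw [← hζ, ← reassoc_of% hσ, reassoc_of% e1]

end TemperedFrobenioid

/-! ### Proposition 4.3 (ii) for every setting of §4 -/

variable {K : Type u₀} [Field K]

namespace BiKummerSetting

variable {X : SemiGraphs.TemperedArithmeticGroup.{u₀} K} {D₀ : Type u₀} [Category.{v₀} D₀]
  {V : FrdIMonoidStub.{w}} {T : RealifiedDivisorMonoids (D₀ := D₀) V} {D : Type u} [Category.{v} D]
  {VD : FrdICatStub.{u, v, w} D} {S : BiKummerSetting X T D VD}

namespace NthRoot

variable {A Bo : S.C} {f : S.biratUnits A} {P : S.FractionPair f Bo} {N : ℕ+}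
  {pullFrac : ∀ {A A' : S.C} (_ : A' ⟶ A), S.biratUnits A → S.biratUnits A'}
  (R : S.NthRoot f P N pullFrac)

/-- **A unit of the `N`-domain lifts to a unit of the `N`-codomain along BOTH `s'_N` and `s''_N`, in
EVERY setting of §4** (proof of Prop. 4.3 (ii), p.91: "[FrdI], Definition 1.3, (iii), (d)"): for
`ζ_A ∈ O^×(A_N)` the automorphism `ζ := (1, id, (b⁻¹)^* Div ζ_A, (b⁻¹)^* u_{ζ_A}) ∈ O^×(B_N)`,
`b := Base(s'_N) = Base(s''_N)`, satisfies `ζ ∘ s'_N = s'_N ∘ ζ_A`, `ζ ∘ s''_N = s''_N ∘ ζ_A` —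
abc-iut-w5-d063's `exists_units_lift` without `Φ` divisorial / `B` group-like.
[cite: MochizukiEtTh2009, Prop 4.3 (ii) p.91] -/
theorem exists_units_lift' {ζA : Aut R.AN} (hζA : ζA ∈ S.units R.AN) :
    ∃ ζB : Aut R.BN, ζB ∈ S.units R.BN ∧ R.pair.num ≫ ζB.hom = ζA.hom ≫ R.pair.num ∧
      R.pair.den ≫ ζB.hom = ζA.hom ≫ R.pair.den := by
  haveI : IsIso (ModelFrobenioid.baseMap R.pair.num) := R.pair.isPreStep_num.2
  have hbP : ModelFrobenioid.baseMap R.pair.num = ModelFrobenioid.baseMap R.pair.den := R.pair.base_eq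
  have hn1 : ModelFrobenioid.degFr R.pair.num = 1 := R.pair.isPreStep_num.1
  have hd1 : ModelFrobenioid.degFr R.pair.den = 1 := R.pair.isPreStep_den.1
  have hζA' : ζA ∈ ModelFrobenioid.units R.AN := ⟨hζA.1, hζA.2⟩
  have hζAb : ModelFrobenioid.baseMap ζA.hom = 𝟙 _ := hζA.1
  have hζAd : ModelFrobenioid.degFr ζA.hom = 1 := hζA.2
  have hrel := ModelFrobenioid.of_div_eq_divB_unit_of_mem_units hζA'
  have hrel' := ModelFrobenioid.of_div_eq_divB_unit_of_mem_units ((ModelFrobenioid.units R.AN).inv_mem hζA')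
  have hdd := ModelFrobenioid.div_inv_mul_div_of_mem_units hζA'
  set b := ModelFrobenioid.baseMap R.pair.num with hb
  let ζB : Aut R.BN := ModelFrobenioid.unitAut R.BN
    (pull S.tf.divisorMonoid (inv b) (ModelFrobenioid.div ζA.hom))
    (pull S.tf.divisorMonoid (inv b) (ModelFrobenioid.div ζA.inv))
    (pull S.tf.ratFnFunctor (inv b) (ModelFrobenioid.unit ζA.hom))
    (pull S.tf.ratFnFunctor (inv b) (ModelFrobenioid.unit ζA.inv))
    (ModelFrobenioid.of_map_eq_divB_map (inv b) hrel) (ModelFrobenioid.of_map_eq_divB_map (inv b) hrel')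
    (by rw [← map_mul, hdd.1, map_one]) (by rw [← map_mul, hdd.2, map_one])
  refine ⟨ζB, ⟨rfl, rfl⟩, ?_, ?_⟩
  · apply ModelFrobenioid.hom_ext
    · show (1 : ℕ+) * ModelFrobenioid.degFr R.pair.num =
        ModelFrobenioid.degFr R.pair.num * ModelFrobenioid.degFr ζA.hom
      rw [hζAd, one_mul, mul_one]
    · show b ≫ 𝟙 _ = ModelFrobenioid.baseMap ζA.hom ≫ b
      rw [hζAb, Category.comp_id, Category.id_comp]
    · show pull S.tf.divisorMonoid b (pull S.tf.divisorMonoid (inv b) (ModelFrobenioid.div ζA.hom)) *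
          ModelFrobenioid.div R.pair.num ^ ((1 : ℕ+) : ℕ) =
        pull S.tf.divisorMonoid (ModelFrobenioid.baseMap ζA.hom) (ModelFrobenioid.div R.pair.num) *
          ModelFrobenioid.div ζA.hom ^ (ModelFrobenioid.degFr R.pair.num : ℕ)
      rw [pull_pull_inv_eq, hζAb, pull_id, hn1, PNat.one_coe, pow_one, pow_one, mul_comm]
    · show pull S.tf.ratFnFunctor b (pull S.tf.ratFnFunctor (inv b) (ModelFrobenioid.unit ζA.hom)) *
          ModelFrobenioid.unit R.pair.num ^ ((1 : ℕ+) : ℕ) =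
        pull S.tf.ratFnFunctor (ModelFrobenioid.baseMap ζA.hom) (ModelFrobenioid.unit R.pair.num) *
          ModelFrobenioid.unit ζA.hom ^ (ModelFrobenioid.degFr R.pair.num : ℕ)
      rw [pull_pull_inv_eq, hζAb, pull_id, hn1, PNat.one_coe, pow_one, pow_one, mul_comm]
  · apply ModelFrobenioid.hom_ext
    · show (1 : ℕ+) * ModelFrobenioid.degFr R.pair.den =
        ModelFrobenioid.degFr R.pair.den * ModelFrobenioid.degFr ζA.hom
      rw [hζAd, one_mul, mul_one]
    · show ModelFrobenioid.baseMap R.pair.den ≫ 𝟙 _ =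
        ModelFrobenioid.baseMap ζA.hom ≫ ModelFrobenioid.baseMap R.pair.den
      rw [hζAb, Category.comp_id, Category.id_comp]
    · show pull S.tf.divisorMonoid (ModelFrobenioid.baseMap R.pair.den)
            (pull S.tf.divisorMonoid (inv b) (ModelFrobenioid.div ζA.hom)) *
          ModelFrobenioid.div R.pair.den ^ ((1 : ℕ+) : ℕ) =
        pull S.tf.divisorMonoid (ModelFrobenioid.baseMap ζA.hom) (ModelFrobenioid.div R.pair.den) *
          ModelFrobenioid.div ζA.hom ^ (ModelFrobenioid.degFr R.pair.den : ℕ)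
      rw [← hbP, pull_pull_inv_eq, hζAb, pull_id, hd1, PNat.one_coe, pow_one, pow_one, mul_comm]
    · show pull S.tf.ratFnFunctor (ModelFrobenioid.baseMap R.pair.den)
            (pull S.tf.ratFnFunctor (inv b) (ModelFrobenioid.unit ζA.hom)) *
          ModelFrobenioid.unit R.pair.den ^ ((1 : ℕ+) : ℕ) =
        pull S.tf.ratFnFunctor (ModelFrobenioid.baseMap ζA.hom) (ModelFrobenioid.unit R.pair.den) *
          ModelFrobenioid.unit ζA.hom ^ (ModelFrobenioid.degFr R.pair.den : ℕ)
      rw [← hbP, pull_pull_inv_eq, hζAb, pull_id, hd1, PNat.one_coe, pow_one, pow_one, mul_comm]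

end NthRoot

/-- **[EtTh] Proposition 4.3 (ii) AS TYPED — the universal closure** (`BiKummerSetting.Prop43_ii`,
p.91: two bi-Kummer `N`-th roots of one `N`-th root with the same identification `H_{A_N} ≅ H_{B_N}` and
`O^×(A_N)`-conjugate trivializing sections differ by the conjugation operations (a), (b)): it holds for
EVERY `S : BiKummerSetting X T D VD` and every transport `pullFrac`, with `ζ ∈ O^×(B_N)` the lift of
`ζ_A` (`exists_units_lift'`) and `u = 1 ∈ μ_N(B_N)` — abc-iut-w5-d063's `prop43_ii_of` with BOTH
structural hypotheses discharged (`B` group-like: `ratFnFunctor_isGroupLike_holds`; `Φ` divisorial: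
not needed, `TemperedFrobenioid.aut_conj_of_comp_eq`).  FACT-LIST row F-0730 (abc-iut-f-110's tranche;
proved here as the input of F-0731). [cite: MochizukiEtTh2009, Prop 4.3 (ii) p.91] -/
theorem prop43_ii_holds :
    ∀ {K : Type u₀} [Field K] {X : SemiGraphs.TemperedArithmeticGroup.{u₀} K} {D₀ : Type u₀}
      [Category.{v₀} D₀] {V : FrdIMonoidStub.{w}} {T : RealifiedDivisorMonoids (D₀ := D₀) V}
      {D : Type u} [Category.{v} D] {VD : FrdICatStub.{u, v, w} D} (S : BiKummerSetting X T D VD)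
      (pullFrac : ∀ {A A' : S.C} (_ : A' ⟶ A), S.biratUnits A → S.biratUnits A'),
      Literature.AnabelianGeometry.EtaleTheta.BiKummerSetting.Prop43_ii S pullFrac := by
  intro K _ X D₀ _ V T D _ VD S pullFrac A Bo f P N R hA hB K₁ K' hident hstriv _
  obtain ⟨ζA, hconjA⟩ := hstriv
  obtain ⟨ζB, hζBu, hnum, hden⟩ := R.exists_units_lift' ζA.2
  haveI : IsIso (ModelFrobenioid.baseMap R.pair.num) := R.pair.isPreStep_num.2
  haveI : IsIso (ModelFrobenioid.baseMap R.pair.den) := R.pair.isPreStep_den.2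
  have h1 : (1 : Aut R.BN) ∈ S.mu R.BN N := ⟨(S.units R.BN).one_mem, one_pow _⟩
  refine ⟨⟨ζB, hζBu⟩, ⟨1, h1⟩, fun h => ?_⟩
  obtain ⟨g, rfl⟩ := K₁.ident.surjective h
  have hg' : K'.ident g = K₁.ident g := by rw [hident]
  constructor
  · show K'.sNum (K₁.ident g) = ζB * K₁.sNum (K₁.ident g) * ζB⁻¹
    have c' := K'.comm_num g
    rw [hg'] at c'
    exact S.tf.aut_conj_of_comp_eq R.pair.num (K₁.comm_num g) c' hnum (hconjA g)
  · show K'.sDen (K₁.ident g) = ((1 : Aut R.BN) * ζB) * K₁.sDen (K₁.ident g) * ((1 : Aut R.BN) * ζB)⁻¹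
    rw [one_mul]
    have c' := K'.comm_den g
    rw [hg'] at c'
    exact S.tf.aut_conj_of_comp_eq R.pair.den (K₁.comm_den g) c' hden (hconjA g)

/-! ### Theorem 4.4 (iv) for every pair of settings -/

/-- **[EtTh] Theorem 4.4 (iv) AS TYPED — the universal closure** (`BiKummerSetting.Thm44_iv`, p.94:
"`Ψ` is compatible with bi-Kummer `N`-th roots", up to the conjugation operations (a), (b) of
Prop. 4.3 (ii)): it holds for EVERY pair of settings `S₁, S₂`, every `Thm44Hyp`, `ψ`, `pullFrac₁`,
`pullFrac₂` — abc-iut-L2-t3's `thm44_iv_of_prop43_ii` fed with `prop43_ii_holds`; no residual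
hypothesis.  FACT-LIST row F-0731 (block F, abc-iut-f-111). [cite: MochizukiEtTh2009, Thm 4.4 (iv) p.94] -/
theorem thm44_iv_holds :
    ∀ {K : Type u₀} [Field K] {K' : Type u₀} [Field K'] {X₁ : SemiGraphs.TemperedArithmeticGroup.{u₀} K}
      {X₂ : SemiGraphs.TemperedArithmeticGroup.{u₀} K'} {D₀ : Type u₀} [Category.{v₀} D₀]
      {D₀' : Type u₀} [Category.{v₀} D₀'] {V : FrdIMonoidStub.{w}}
      {T₁ : RealifiedDivisorMonoids (D₀ := D₀) V} {T₂ : RealifiedDivisorMonoids (D₀ := D₀') V}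
      {D₁ D₂ : Type u} [Category.{v} D₁] [Category.{v} D₂] {VD₁ : FrdICatStub.{u, v, w} D₁}
      {VD₂ : FrdICatStub.{u, v, w} D₂} {S₁ : BiKummerSetting X₁ T₁ D₁ VD₁}
      {S₂ : BiKummerSetting X₂ T₂ D₂ VD₂} (h : Thm44Hyp S₁ S₂)
      (ψ : ∀ A : S₁.C, S₁.biratUnits A ≃* S₂.biratUnits (h.Ψ.functor.obj A))
      (pullFrac₁ : ∀ {A A' : S₁.C} (_ : A' ⟶ A), S₁.biratUnits A → S₁.biratUnits A')
      (pullFrac₂ : ∀ {A A' : S₂.C} (_ : A' ⟶ A), S₂.biratUnits A → S₂.biratUnits A'),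
      Literature.AnabelianGeometry.EtaleTheta.BiKummerSetting.Thm44_iv h ψ pullFrac₁ pullFrac₂ :=
  fun h ψ pullFrac₁ pullFrac₂ => thm44_iv_of_prop43_ii h ψ pullFrac₁ pullFrac₂ (prop43_ii_holds _ pullFrac₂)

end BiKummerSetting

end Literature.AnabelianGeometry.EtaleTheta

end
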